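import Summits.KontsevichZagierPeriods.KontsevichZagierPeriods.Theses.SymplecticScissors
import Summits.KontsevichZagierPeriods.KontsevichZagierPeriods.Theorems.SymplecticScissorsTypeAGenerationRatOneVarLayer
import Summits.KontsevichZagierPeriods.KontsevichZagierPeriods.Theorems.SymplecticScissorsTypeAGenerationStubCovPolyAux
import Summits.KontsevichZagierPeriods.KontsevichZagierPeriods.Theorems.SymplecticScissorsTypeAGenerationStubCovSubstAnalytic
import Summits.KontsevichZagierPeriods.KontsevichZagierPeriods.Theorems.SymplecticScissorsTypeAGenerationStubCovSubstMemOan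
import Summits.KontsevichZagierPeriods.KontsevichZagierPeriods.Theorems.SymplecticScissorsTypeAGenerationStubCovChainRule
import Summits.KontsevichZagierPeriods.KontsevichZagierPeriods.Theorems.SymplecticScissorsTypeAGenerationStubCovFaces
import Summits.KontsevichZagierPeriods.KontsevichZagierPeriods.Theorems.TypeAGeneration.Negative.HypothesesAudit
import Literature.NumberTheory.Transcendental.AyoubPeriodSeriesLocalizing
import Literature.NumberTheory.Transcendental.AyoubPeriodSeriesTorsion

/-!
# `TypeAGeneration` (stmt-KontsevichZagierPeriods-18392), line `Sketch`: CHANGE OF VARIABLES IN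
DIMENSION ONE inside type (a), and the genus-0-with-room layer (registered stubs
`stub_changeOfVariablesDimOne`, `stub_genusZeroWithRoomLayer`; lead assembly of wave 3, cycle 2)

**Engine (C3, n = 1) of the line `Sketch` (card stokes-compiler) — Ayoub 2015 Rem. 1.5 inside the
algebra.** For a polynomial `u ∈ ℚ̄[t]` with `u(0) = 0`, `u(1) = 1` and a one-variable
`f ∈ 𝒪_{ℚ-alg}(𝔻̄^∞)` (variable `zᵢ`) with ROOM — polyradius `> 2 + Σ_k |u_k|`, which is free at
the level of the crux by the room normalisation of cycle 1 —

  `f(zᵢ) − f(u(zᵢ)) · u′(zᵢ)` lies in the `ℚ`-span of the type-(a) elements.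

Certificate: along the straight-line homotopy `H = zᵢ(1 − z_j) + u(zᵢ) z_j` (`j ≠ i` auxiliary;
`H|_{z_j=0} = zᵢ`, `H|_{z_j=1} = u(zᵢ)`) the 1-form `f(H) dH` is closed: with `T = f(H)`
(`MvPowerSeries.subst`), `A = T ∂ᵢH`, `B = T ∂_jH` one has `∂_jA = ∂ᵢB` (chain rule V2
`stub_covChainRule` and `∂ᵢ∂_j = ∂_j∂ᵢ`), `A|_{z_j=1} = f(u) u′`, `A|_{z_j=0} = f` (faces V3
`stub_covFaces_of`, fed by the analytic substitution package V0 `stub_covSubstAnalytic`),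
`B|_{zᵢ=1} = 0 = B|_{zᵢ=0}` (`u(1) = 1`, `u(0) = 0`), and `A, B ∈ 𝒪_{ℚ-alg}(𝔻̄^∞)` (membership V1
`stub_covSubstMemOan_of`, polynomial package `stub_covPolyAux`); hence
`f − f(u)u′ = relAC j A − relAC i B`.

**Layer 1.5** (`stub_genusZeroWithRoomLayer`): if moreover the pulled-back integrand `f(u)u′` is
RATIONAL with algebraic coefficients, then `∫ f = 0 ⟹ f` is type (a) — the span integrates to zero
and Layer 1 (`stub_ratOneVarLayer`) applies to `f(u)u′`. (Genus-0 one-variable algebraic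
integrands with a polynomial parametrisation and room.)

References: Ayoub, Ann. of Math. 181 (2015), Rem. 1.5 (the homotopy `g = (u − z₁) f(u z₂ + z₁(1 − z₂))`),
Conj. 1.1; Fresán 2024 Rem. 3.7.
-/

noncomputable section

-- `Summit.KontsevichZagierPeriods.KontsevichZagierPeriods.…` is the tree's mandated layout (single-conjunct summit).
set_option linter.dupNamespace false

namespace Summit.KontsevichZagierPeriods.KontsevichZagierPeriods.TypeAGenerationLine

open Finsupp MvPowerSeries
open Literature.NumberTheory.Transcendental
open Literature.NumberTheory.Transcendental.AyoubRel
open Summit.KontsevichZagierPeriods.SymplecticScissors.TypeAGenerationNegative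
  (intC_eq_zero_of_mem_kSpan_relAC)

/-- The straight-line homotopy `H = zᵢ(1 − z_j) + u(zᵢ) z_j` between `zᵢ` (`z_j = 0`) and `u(zᵢ)`
(`z_j = 1`) of Ayoub 2015 Rem. 1.5. -/
local notation3 "covH[" i ", " j ", " u "]" =>
  ((X i : CSeries) * (1 - X j) + Polynomial.aeval (X i : CSeries) u * X j)

/-- The substitution family `zᵢ ↦ H`, `z_l ↦ z_l` (`l ≠ i`). -/
local notation3 "covFam[" i ", " j ", " u "]" =>
  (fun l : ℕ => if l = i then covH[i, j, u] else (X l : CSeries))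

/-- The substitution family `zᵢ ↦ u(zᵢ)`, `z_l ↦ z_l` (`l ≠ i`). -/
local notation3 "uFam[" i ", " u "]" =>
  (fun l : ℕ => if l = i then Polynomial.aeval (X i : CSeries) u else (X l : CSeries))

/-- **COV1 (lead assembly) — CHANGE OF VARIABLES IN DIMENSION ONE inside type (a)** (Ayoub 2015
Rem. 1.5): for `u ∈ ℚ̄[t]` with `u(0) = 0`, `u(1) = 1` and a one-variable `f ∈ 𝒪_{ℚ-alg}(𝔻̄^∞)`
(variable `zᵢ`) with polyradius `> 2 + Σ|u_k|`: `f − f(u(zᵢ)) · u′(zᵢ) ∈ ⟨a⟩_ℚ`. Certificate: with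
`T = f(H)`, `H = zᵢ(1 − z_j) + u(zᵢ)z_j`, `A = T ∂ᵢH`, `B = T ∂_jH` one has `∂_jA = ∂ᵢB` (chain
rule V2, `∂ᵢ∂_j = ∂_j∂ᵢ`), `A|_{z_j=1} = f(u) u′`, `A|_{z_j=0} = f` (faces V3), `B|_{zᵢ=1} = 0 = B|_{zᵢ=0}`
(`u(1) = 1`, `u(0) = 0`), so `f − f(u)u′ = relAC j A − relAC i B`. [cite: Ayoub2015, Rem. 1.5] -/
theorem stub_changeOfVariablesDimOne :
    ∀ (i j : ℕ), i ≠ j → ∀ (u : Polynomial ℂ), (∀ n, IsAlgebraic ℚ (u.coeff n)) →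
      u.eval 0 = 0 → u.eval 1 = 1 →
      ∀ (f : CSeries), f ∈ Oan (algebraMap ℚ ℂ) → (∀ l : ℕ, UsesVar f l → l = i) →
      ∀ (r : ℝ), 2 + (∑ n ∈ u.support, ‖u.coeff n‖) < r →
        Summable (fun a : ℕ →₀ ℕ => ‖MvPowerSeries.coeff a f‖ * r ^ degree a) →
        f - MvPowerSeries.subst uFam[i, u] f * Polynomial.aeval (X i : CSeries) (Polynomial.derivative u) ∈
          (kSpan (algebraMap ℚ ℂ) {x : CSeries | ∃ G ∈ Oan (algebraMap ℚ ℂ), ∃ n : ℕ, x = relAC n G}) := by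
  intro i j hij u hualg hu0 hu1 f hf hvar r hr hsum
  -- the four stubs
  obtain ⟨-, -, hTvar, hfuvar, -, -, ρ, hρ1, -, -, -, hTs, hfus, -⟩ :=
    stub_covSubstAnalytic i j hij u hu0 f hvar r hr hsum
  obtain ⟨hTOan, hfuOan⟩ :=
    stub_covSubstMemOan_of stub_covSubstAnalytic i j hij u hualg hu0 f hf hvar r hr hsum
  have hchain := stub_covChainRule i j hij u f hvar
  obtain ⟨hface1, hface0⟩ := stub_covFaces_of stub_covSubstAnalytic i j hij u hu0 f hvar r hr hsum
  -- names
  set T : CSeries := MvPowerSeries.subst covFam[i, j, u] f with hTdef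
  set fu : CSeries := MvPowerSeries.subst uFam[i, u] f with hfudef
  set S : CSeries := MvPowerSeries.subst covFam[i, j, u] (pdz i f) with hSdef
  set U : CSeries := Polynomial.aeval (X i : CSeries) u with hUdef
  set U' : CSeries := Polynomial.aeval (X i : CSeries) (Polynomial.derivative u) with hU'def
  set H : CSeries := covH[i, j, u] with hHdef
  have hji : j ≠ i := fun h => hij h.symm
  -- the polynomial package
  obtain ⟨hpdzU, hpdzU_ne, hU1, hU0, hUvar, hUsum, hUOan⟩ := stub_covPolyAux i u
  obtain ⟨-, hpdzU'_ne, -, -, hU'var, hU'sum, hU'Oan⟩ := stub_covPolyAux i (Polynomial.derivative u)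
  have hU'j : ¬ UsesVar U' j := fun h => hji (hU'var j h)
  have hUj : ¬ UsesVar U j := fun h => hji (hUvar j h)
  -- derivatives of `H`
  have hadd : ∀ (l : ℕ) (F G : CSeries), pdz l (F + G) = pdz l F + pdz l G := by
    intro l F G
    have e := w1_pdz_smul_add l F G 1
    rwa [one_smul, one_smul] at e
  have h1Xj : ∀ l : ℕ, pdz l ((1 : CSeries) - X j) = -(pdz l (X j)) := by
    intro l
    rw [sub_eq_add_neg, ← neg_one_smul ℂ (X j : CSeries), add_comm, w1_pdz_smul_add, n1_pdz_one,
      add_zero, neg_one_smul]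
  have hHi : pdz i H = (1 - X j) + U' * X j := by
    rw [hHdef, hadd, w1_pdz_mul, w1_pdz_X, if_pos rfl, one_mul, h1Xj, w1_pdz_X, if_neg hji, neg_zero,
      mul_zero, add_zero, w1_pdz_mul, hpdzU, w1_pdz_X, if_neg hji, mul_zero, add_zero]
  have hHj : pdz j H = U - X i := by
    rw [hHdef, hadd, w1_pdz_mul, w1_pdz_X, if_neg hij, zero_mul, zero_add, h1Xj, w1_pdz_X, if_pos rfl,
      w1_pdz_mul, hpdzU_ne j hji, zero_mul, zero_add, w1_pdz_X, if_pos rfl, mul_one, hUdef]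
    ring
  -- the Jacobian factor `D = ∂ᵢH = 1 + (u′(zᵢ) − 1) z_j` and the certificates `A`, `B`
  set D : CSeries := 1 + (U' - 1) * X j with hDdef
  have hHiD : pdz i H = D := by rw [hHi, hDdef]; ring
  set A : CSeries := T * D with hAdef
  set B : CSeries := T * (U - X i) with hBdef
  -- memberships
  have hU'alg : ∀ n, IsAlgebraic ℚ ((Polynomial.derivative u).coeff n) := fun n => by
    rw [Polynomial.coeff_derivative]
    exact (hualg (n + 1)).mul ((isAlgebraic_nat n).add isAlgebraic_one)
  have h1Oan : (1 : CSeries) ∈ Oan (algebraMap ℚ ℂ) := one_mem_Oan _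
  have hDOan : D ∈ Oan (algebraMap ℚ ℂ) :=
    add_mem_Oan _ h1Oan (mul_mem_Oan _ (sub_mem_Oan _ (hU'Oan hU'alg) h1Oan) (s2_X_mem_Oan _ j))
  have hUXOan : U - X i ∈ Oan (algebraMap ℚ ℂ) := sub_mem_Oan _ (hUOan hualg) (s2_X_mem_Oan _ i)
  have hAOan : A ∈ Oan (algebraMap ℚ ℂ) := mul_mem_Oan _ hTOan hDOan
  have hBOan : B ∈ Oan (algebraMap ℚ ℂ) := mul_mem_Oan _ hTOan hUXOan
  have sT := summable_norm_coeff_of_mem_Oan (algebraMap ℚ ℂ) hTOan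
  have sD := summable_norm_coeff_of_mem_Oan (algebraMap ℚ ℂ) hDOan
  have sUX := summable_norm_coeff_of_mem_Oan (algebraMap ℚ ℂ) hUXOan
  have sU'1 := summable_norm_coeff_of_mem_Oan (algebraMap ℚ ℂ) (sub_mem_Oan _ (hU'Oan hU'alg) h1Oan)
  -- (1) closedness `∂_j A = ∂ᵢ B`
  have hclosed : pdz j A - pdz i B = 0 := by
    rw [hAdef, hBdef, ← hHiD, ← hHj, w1_pdz_mul, w1_pdz_mul, hchain j, hchain i, w1_pdz_comm j i]
    ring
  -- (2) faces of `A` in the `z_j`-direction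
  have hU'1j : ¬ UsesVar (U' - 1) j := by
    intro h
    rcases usesVar_sub h with h' | h'
    · exact hU'j h'
    · exact not_usesVar_one _ h'
  have hD1 : restrC j 1 D = U' := by
    rw [hDdef, s4_restrC_add j (summable_norm_coeff_of_mem_Oan (algebraMap ℚ ℂ) h1Oan)
      (s4_summable_norm_coeff_mul sU'1 (c3_summable_X j)), s4_restrC_one,
      s4_restrC_mul sU'1 (c3_summable_X j), s4_restrC_X, if_pos rfl, mul_one,
      d1_restrC_one_of_not_usesVar hU'1j]
    ring
  have hD0 : restrC j 0 D = 1 := by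
    rw [hDdef, s8_restrC_zero_add, s8_restrC_zero_mul, s8_restrC_zero_X_self, mul_zero, add_zero,
      c3_restrC_zero_of_not_usesVar (not_usesVar_one j)]
  have hA1 : restrC j 1 A = fu * U' := by
    rw [hAdef, s4_restrC_mul sT sD, hD1, hTdef, hface1]
  have hA0 : restrC j 0 A = f := by
    rw [hAdef, s8_restrC_zero_mul, hD0, mul_one, hTdef, hface0]
  -- (3) faces of `B` in the `zᵢ`-direction vanish (`u(1) = 1`, `u(0) = 0`)
  have hB1 : restrC i 1 B = 0 := by
    have hnX : Summable fun a : ℕ →₀ ℕ => ‖coeff a (-(X i : CSeries))‖ := by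
      simpa only [map_neg, norm_neg] using c3_summable_X i
    rw [hBdef, s4_restrC_mul sT sUX, sub_eq_add_neg, s4_restrC_add i hUsum hnX,
      ← neg_one_smul ℂ (X i : CSeries), restrC_smul, s4_restrC_X, if_pos rfl, hU1, hu1, map_one,
      neg_one_smul, add_neg_cancel, mul_zero]
  have hB0 : restrC i 0 B = 0 := by
    rw [hBdef, s8_restrC_zero_mul, sub_eq_add_neg, s8_restrC_zero_add, ← neg_one_smul ℂ (X i : CSeries),
      restrC_smul, s8_restrC_zero_X_self, smul_zero, add_zero, hU0, hu0, map_zero, mul_zero]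
  -- (4) the certificate
  have hcert : f - fu * U' = relAC j A - relAC i B := by
    rw [relAC, relAC, hA1, hA0, hB1, hB0, sub_zero, add_zero]
    have e : pdz j A = pdz i B := sub_eq_zero.mp hclosed
    rw [e]
    ring
  rw [show MvPowerSeries.subst uFam[i, u] f * Polynomial.aeval (X i : CSeries) (Polynomial.derivative u)
      = fu * U' from rfl, hcert]
  exact kSpan_sub _ (subset_kSpan _ _ ⟨A, hAOan, j, rfl⟩) (subset_kSpan _ _ ⟨B, hBOan, i, rfl⟩)

/-- **LAYER 1.5 (lead assembly) — GENUS-0 one-variable integrands WITH ROOM and a polynomial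
parametrisation.** If `F ∈ 𝒪_{ℚ-alg}(𝔻̄^∞)` involves `zᵢ` only, has polyradius `> 2 + Σ|u_k|` for some
`u ∈ ℚ̄[t]` with `u(0) = 0`, `u(1) = 1`, and the pulled-back integrand `F(u(zᵢ))·u′(zᵢ)` is RATIONAL
(`B·(F(u)u′) = A`, `A, B ∈ ℚ̄[zᵢ]`, `B ≠ 0`), then `∫F = 0 ⟹ F ∈ ⟨a⟩_ℚ`: COV1 gives
`F ≡ F(u)u′`, the span integrates to zero, and Layer 1 applies to `F(u)u′`. [cite: Ayoub2015, Rem. 1.5] -/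
theorem stub_genusZeroWithRoomLayer :
    ∀ (i : ℕ) (u : Polynomial ℂ), (∀ n, IsAlgebraic ℚ (u.coeff n)) → u.eval 0 = 0 → u.eval 1 = 1 →
      ∀ (F : CSeries), F ∈ Oan (algebraMap ℚ ℂ) → (∀ l : ℕ, UsesVar F l → l = i) →
      ∀ (r : ℝ), 2 + (∑ n ∈ u.support, ‖u.coeff n‖) < r →
        Summable (fun a : ℕ →₀ ℕ => ‖MvPowerSeries.coeff a F‖ * r ^ degree a) →
        (∃ A B : Polynomial ℂ, B ≠ 0 ∧ (∀ n, IsAlgebraic ℚ (A.coeff n)) ∧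
          (∀ n, IsAlgebraic ℚ (B.coeff n)) ∧
          Polynomial.aeval (X i : CSeries) B *
              (MvPowerSeries.subst uFam[i, u] F * Polynomial.aeval (X i : CSeries) (Polynomial.derivative u)) =
            Polynomial.aeval (X i : CSeries) A) →
        intC F = 0 → F ∈
          (kSpan (algebraMap ℚ ℂ) {x : CSeries | ∃ G ∈ Oan (algebraMap ℚ ℂ), ∃ n : ℕ, x = relAC n G}) := by
  intro i u hualg hu0 hu1 F hF hvar r hr hsum hrat hF0
  have hij : i ≠ i + 1 := by omega
  have hcov := stub_changeOfVariablesDimOne i (i + 1) hij u hualg hu0 hu1 F hF hvar r hr hsum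
  set G : CSeries := MvPowerSeries.subst uFam[i, u] F *
    Polynomial.aeval (X i : CSeries) (Polynomial.derivative u) with hGdef
  -- `G ∈ 𝒪_{ℚ-alg}`, one variable
  obtain ⟨-, -, -, hfuvar, -⟩ := stub_covSubstAnalytic i (i + 1) hij u hu0 F hvar r hr hsum
  obtain ⟨-, hfuOan⟩ :=
    stub_covSubstMemOan_of stub_covSubstAnalytic i (i + 1) hij u hualg hu0 F hF hvar r hr hsum
  have hU'alg : ∀ n, IsAlgebraic ℚ ((Polynomial.derivative u).coeff n) := fun n => by
    rw [Polynomial.coeff_derivative]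
    exact (hualg (n + 1)).mul ((isAlgebraic_nat n).add isAlgebraic_one)
  have hGOan : G ∈ Oan (algebraMap ℚ ℂ) := mul_mem_Oan _ hfuOan (c3_aeval_mem_Oan i hU'alg)
  have hGvar : ∀ l : ℕ, UsesVar G l → l = i := by
    intro l hl
    rcases usesVar_mul hl with h | h
    · exact hfuvar l h
    · exact c3_usesVar_aeval h
  -- `∫ G = 0`
  have hG0 : intC G = 0 := by
    have h := intC_sub (summable_norm_coeff_of_mem_Oan (algebraMap ℚ ℂ) hF)
      (summable_norm_coeff_of_mem_kSpan_relAC (algebraMap ℚ ℂ) hcov)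
    rw [sub_sub_cancel, hF0, intC_eq_zero_of_mem_kSpan_relAC (algebraMap ℚ ℂ) hcov, sub_zero] at h
    exact h
  -- Layer 1 for `G`, then `F = (F − G) + G`
  have hG := stub_ratOneVarLayer ℚ (algebraMap ℚ ℂ) (fun c => isAlgebraic_algebraMap c) i G hGOan hGvar
    hrat hG0
  have h := kSpan_add _ hcov hG
  rwa [sub_add_cancel] at h

end Summit.KontsevichZagierPeriods.KontsevichZagierPeriods.TypeAGenerationLine
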